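import Literature.Computability.AlgebraicComplexity.BorderRankMatMulRectangular
import Literature.Computability.AlgebraicComplexity.BorderRankDirectSum
import HarnessLib

/-!
# Landsberg–Ryder 2017, Prop. 3.1 (gluing reduced `⟨m,2,2⟩` schemes along a shared row): proved — the named fact `LandsbergRyder2017_prop_3_1` becomes a theorem

Topic `Literature/Computability/AlgebraicComplexity`; a `…Proofs`-style sibling of
`BorderRankMatMulRectangular.lean`, which vendors as a named fact

* `LandsbergRyder2017_prop_3_1`: "If `R̲(T_{BCLRS,m}) = r` and `R̲(T_{BCLRS,m'}) = r'`, then setting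
  `n = m + m' − 1`, `R̲(M_⟨n,2,2⟩) ≤ r + r'`" (J. M. Landsberg, N. Ryder, *On the geometry of border
  rank algorithms for n × 2 by 2 × 2 matrix multiplication*, Exp. Math. 26 (2017) 275–286 =
  arXiv:1509.08323, §3 Prop. 3.1: "The following observation dates back to [BCLR79]"), where
  `T_{BCLRS,m}` is `M_⟨m,2,2⟩` with the `A`-slot coordinate `x¹₁` killed (rendered in the tree as
  `fun c a b => if a = (⟨0,hm⟩, 0) then 0 else matMulTensor ℂ m 2 2 c a b`).

THIS FILE PROVES IT (`LandsbergRyder2017_prop_3_1_holds`), over every commutative ring in the general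
form `algBorderRank_matMulTensor_glue_le`, by the one-line argument of the source made formal:
place the first reduced scheme on the rows `0, …, m−1` of the `(m+m'−1) × 2` matrix `X` REVERSED (so
that its killed entry sits at the shared row `m−1`, column `0`), the second on the rows
`m−1, …, m+m'−2` with the two columns of `X` (and, correspondingly, the two rows of `Y`) EXCHANGED (so
that its killed entry sits at the shared row, column `1`); the two zero-extended tensors SUM to
`M_⟨m+m'−1,2,2⟩` (the shared row `x_{m−1,0} y_{0,·} + x_{m−1,1} y_{1,·}` is split between them), and
border rank is subadditive and does not grow under zero-extension / relabelling.

## Contents (all proved; `K` any commutative ring)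

* `IsApproxDecomposition.add`, `approxRank_add_le`, `algBorderRank_add_le` — **subadditivity of
  `R_h` and of border rank under `+`** (BCS 1997, §15.2: "the border rank shares some of the
  properties of the rank: it is subadditive"; the `⊕` version is `BorderRankDirectSum.lean`);
* `optPullTensor`, `IsApproxDecomposition.optPull`, `approxRank_optPull_le`, `algBorderRank_optPull_le` —
  zero-extension combined with relabelling along partial maps `ι' → Option ι` does not increase
  `R_h` / `bR` (decomposition vectors are pulled back and extended by `0`);
* `reducedM22` (the tree's rendering of `T_{BCLRS,m}`), `matMulTensor_eq_glue` (the pointwise identity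
  `M_⟨p+1+q,2,2⟩ = T₁ + T₂`), `algBorderRank_matMulTensor_glue_le`
  (`bR(M_⟨p+1+q,2,2⟩) ≤ bR(T_{BCLRS,p+1}) + bR(T_{BCLRS,q+1})`), and `LandsbergRyder2017_prop_3_1_holds`.

## References

* [LandsbergRyder2015] J. M. Landsberg, N. Ryder, Exp. Math. 26 (2017) 275–286 = arXiv:1509.08323 —
  §3, Prop. 3.1 (p. 5).
* [BurgisserClausenShokrollahi1997] P. Bürgisser, M. Clausen, M. A. Shokrollahi, *Algebraic
  Complexity Theory* (1997) — §15.2 (border rank subadditive), Prop. (14.23).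
* [Blaser2013] M. Bläser, *Fast Matrix Multiplication* (2013) — Def. 6.1, Thm. 6.3.
-/

noncomputable section

open scoped BigOperators Polynomial
open Polynomial

namespace Literature.Computability.AlgebraicComplexity

universe u v₁ v₂ v₃ v₄ v₅ v₆

variable {K : Type u} [CommRing K]
variable {ι : Type v₁} {κ : Type v₂} {μ : Type v₃} {ι' : Type v₄} {κ' : Type v₅} {μ' : Type v₆}

/-! ## Subadditivity of `R_h` and `bR` under `+` -/

/-- Concatenating two order-`h` approximate decompositions of `s` (`r` triads) and `t` (`r'` triads)
gives one of `s + t` with `r + r'` triads. [cite: BurgisserClausenShokrollahi1997, §15.2 (border rank is subadditive)] -/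
theorem IsApproxDecomposition.add {h : ℕ} {s t : ι → κ → μ → K} {r r' : ℕ}
    {u : Fin r → ι → K[X]} {v : Fin r → κ → K[X]} {w : Fin r → μ → K[X]}
    {u' : Fin r' → ι → K[X]} {v' : Fin r' → κ → K[X]} {w' : Fin r' → μ → K[X]}
    (hs : IsApproxDecomposition h s u v w) (ht : IsApproxDecomposition h t u' v' w') :
    IsApproxDecomposition h (s + t) (Fin.append u u') (Fin.append v v') (Fin.append w w') := by
  intro a b c j hj
  rw [Fin.sum_univ_add]
  simp only [Fin.append_left, Fin.append_right, Polynomial.coeff_add]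
  rw [hs a b c j hj, ht a b c j hj]
  split_ifs <;> simp

/-- **`R_h(s + t) ≤ R_h(s) + R_h(t)`.** [cite: BurgisserClausenShokrollahi1997, §15.2 (border rank is subadditive)] -/
theorem approxRank_add_le [Fintype ι] [Fintype κ] [Fintype μ] [DecidableEq ι] [DecidableEq κ]
    [DecidableEq μ] (h : ℕ) (s t : ι → κ → μ → K) :
    approxRank h (s + t) ≤ approxRank h s + approxRank h t := by
  obtain ⟨u, v, w, hs⟩ := exists_isApproxDecomposition_approxRank h s
  obtain ⟨u', v', w', ht⟩ := exists_isApproxDecomposition_approxRank h t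
  exact approxRank_le_of_isApproxDecomposition (hs.add ht)

/-- **Border rank is subadditive: `bR(s + t) ≤ bR(s) + bR(t)`** (take a common order `max h₁ h₂`).
[cite: BurgisserClausenShokrollahi1997, §15.2 (border rank is subadditive)] -/
theorem algBorderRank_add_le [Fintype ι] [Fintype κ] [Fintype μ] [DecidableEq ι] [DecidableEq κ]
    [DecidableEq μ] (s t : ι → κ → μ → K) :
    algBorderRank (s + t) ≤ algBorderRank s + algBorderRank t := by
  obtain ⟨h₁, hh₁⟩ := exists_algBorderRank_eq_approxRank s
  obtain ⟨h₂, hh₂⟩ := exists_algBorderRank_eq_approxRank t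
  calc algBorderRank (s + t) ≤ approxRank (max h₁ h₂) (s + t) := algBorderRank_le_approxRank _ _
    _ ≤ approxRank (max h₁ h₂) s + approxRank (max h₁ h₂) t := approxRank_add_le _ s t
    _ ≤ approxRank h₁ s + approxRank h₂ t :=
        Nat.add_le_add (approxRank_le_approxRank_of_le (le_max_left _ _) s)
          (approxRank_le_approxRank_of_le (le_max_right _ _) t)
    _ = algBorderRank s + algBorderRank t := by rw [hh₁, hh₂]

/-! ## Zero-extension along partial relabellings -/

/-- Pull a tensor back along partial maps `ι' → Option ι` (etc.): the entry at `(a', b', c')` is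
`t a b c` when all three indices map to `some`, and `0` otherwise — zero-extension combined with
relabelling / duplication of coordinates. [folklore] -/
def optPullTensor (t : ι → κ → μ → K) (f : ι' → Option ι) (g : κ' → Option κ) (e : μ' → Option μ) :
    ι' → κ' → μ' → K :=
  fun a' b' c' => (f a').elim 0 fun a => (g b').elim 0 fun b => (e c').elim 0 fun c => t a b c

/-- Pulling back the decomposition vectors (extended by `0` where the partial map is undefined) gives
an approximate decomposition of the pulled-back tensor, of the same order and length (the pulled-back tensor is
a restriction of `t` in the sense of CGLV §1.1 / Bläser Thm. 6.3). [cite: ConnerGesmundoLandsbergVentura2022, §1.1 (border rank is monotone under restriction)] [cite: Blaser2013, Thm. 6.3] -/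
theorem IsApproxDecomposition.optPull {h : ℕ} {t : ι → κ → μ → K} {r : ℕ} {u : Fin r → ι → K[X]}
    {v : Fin r → κ → K[X]} {w : Fin r → μ → K[X]} (H : IsApproxDecomposition h t u v w)
    (f : ι' → Option ι) (g : κ' → Option κ) (e : μ' → Option μ) :
    IsApproxDecomposition h (optPullTensor t f g e) (fun ρ a' => (f a').elim 0 (u ρ))
      (fun ρ b' => (g b').elim 0 (v ρ)) (fun ρ c' => (e c').elim 0 (w ρ)) := by
  intro a' b' c' j hj
  unfold optPullTensor
  rcases hf : f a' with _ | a
  · simp [hf]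
  rcases hg : g b' with _ | b
  · simp [hf, hg]
  rcases he : e c' with _ | c
  · simp [hf, hg, he]
  simpa [hf, hg, he] using H a b c j hj

/-- `R_h` does not grow under `optPullTensor` (zero-extension and relabelling are restrictions).
[cite: ConnerGesmundoLandsbergVentura2022, §1.1 (border rank is monotone under restriction)] [cite: Blaser2013, Thm. 6.3] -/
theorem approxRank_optPull_le [Fintype ι] [Fintype κ] [Fintype μ] [DecidableEq ι] [DecidableEq κ]
    [DecidableEq μ] [Fintype ι'] [Fintype κ'] [Fintype μ'] [DecidableEq ι'] [DecidableEq κ']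
    [DecidableEq μ'] (h : ℕ) (t : ι → κ → μ → K) (f : ι' → Option ι) (g : κ' → Option κ)
    (e : μ' → Option μ) : approxRank h (optPullTensor t f g e) ≤ approxRank h t := by
  obtain ⟨u, v, w, huvw⟩ := exists_isApproxDecomposition_approxRank h t
  exact approxRank_le_of_isApproxDecomposition (huvw.optPull f g e)

/-- Border rank does not grow under `optPullTensor` (zero-extension and relabelling are restrictions).
[cite: ConnerGesmundoLandsbergVentura2022, §1.1 (border rank is monotone under restriction)] [cite: Blaser2013, Thm. 6.3] -/
theorem algBorderRank_optPull_le [Fintype ι] [Fintype κ] [Fintype μ] [DecidableEq ι] [DecidableEq κ]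
    [DecidableEq μ] [Fintype ι'] [Fintype κ'] [Fintype μ'] [DecidableEq ι'] [DecidableEq κ']
    [DecidableEq μ'] (t : ι → κ → μ → K) (f : ι' → Option ι) (g : κ' → Option κ)
    (e : μ' → Option μ) : algBorderRank (optPullTensor t f g e) ≤ algBorderRank t := by
  obtain ⟨h₀, hh₀⟩ := exists_algBorderRank_eq_approxRank t
  calc algBorderRank (optPullTensor t f g e) ≤ approxRank h₀ (optPullTensor t f g e) :=
        algBorderRank_le_approxRank h₀ _
    _ ≤ approxRank h₀ t := approxRank_optPull_le h₀ t f g e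
    _ = algBorderRank t := hh₀.symm

/-! ## The reduced tensor `T_{BCLRS,m}` and the gluing identity -/

variable (K)

/-- The tree's rendering of Landsberg–Ryder's reduced tensor `T_{BCLRS,p+1}`: `M_⟨p+1,2,2⟩` with the
`A`-slot coordinate `(0,0)` (the entry `x¹₁`) killed (the test is on the value of the row index, which
makes the bookkeeping below purely arithmetical). [cite: LandsbergRyder2015, §3 (the tensor T_{BCLRS,m})] -/
def reducedM22 (p : ℕ) : Fin (p + 1) × Fin 2 → Fin (p + 1) × Fin 2 → Fin 2 × Fin 2 → K :=
  fun c a b => if a.1.val = 0 ∧ a.2 = 0 then 0 else matMulTensor K (p + 1) 2 2 c a b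

/-- Partial row map for the first block: the rows `0, …, p` of the big matrix, REVERSED onto the rows
of `T_{BCLRS,p+1}` (big row `p` ↦ small row `0`), the column kept. [cite: LandsbergRyder2015, §3 Prop. 3.1] -/
def glueMap₁ (p q : ℕ) (c : Fin (p + 1 + q) × Fin 2) : Option (Fin (p + 1) × Fin 2) :=
  if h : c.1.val ≤ p then some (⟨p - c.1.val, by omega⟩, c.2) else none

/-- Partial row map for the second block: the rows `p, …, p+q` of the big matrix onto the rows of
`T_{BCLRS,q+1}` (big row `p` ↦ small row `0`), the column kept. [cite: LandsbergRyder2015, §3 Prop. 3.1] -/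
def glueMap₂ (p q : ℕ) (c : Fin (p + 1 + q) × Fin 2) : Option (Fin (q + 1) × Fin 2) :=
  if h : p ≤ c.1.val then some (⟨c.1.val - p, by omega⟩, c.2) else none

/-- The same for the `A`-slot of the second block, with the two columns EXCHANGED (`Fin.rev`), so that
the killed entry of `T_{BCLRS,q+1}` lands at `(p, 1)`. [cite: LandsbergRyder2015, §3 Prop. 3.1] -/
def glueMap₂' (p q : ℕ) (a : Fin (p + 1 + q) × Fin 2) : Option (Fin (q + 1) × Fin 2) :=
  if h : p ≤ a.1.val then some (⟨a.1.val - p, by omega⟩, a.2.rev) else none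

/-- The first summand: `T_{BCLRS,p+1}` on the big rows `0, …, p` (reversed), zero elsewhere.
[cite: LandsbergRyder2015, §3 Prop. 3.1] -/
def glueBlock₁ (p q : ℕ) :
    Fin (p + 1 + q) × Fin 2 → Fin (p + 1 + q) × Fin 2 → Fin 2 × Fin 2 → K :=
  optPullTensor (reducedM22 K p) (glueMap₁ p q) (glueMap₁ p q) some

/-- The second summand: `T_{BCLRS,q+1}` on the big rows `p, …, p+q`, columns of `X` and rows of `Y`
exchanged, zero elsewhere. [cite: LandsbergRyder2015, §3 Prop. 3.1] -/
def glueBlock₂ (p q : ℕ) :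
    Fin (p + 1 + q) × Fin 2 → Fin (p + 1 + q) × Fin 2 → Fin 2 × Fin 2 → K :=
  optPullTensor (reducedM22 K q) (glueMap₂ p q) (glueMap₂' p q) fun b => some (b.1.rev, b.2)

/-- Closed form of the first summand at a point. [cite: LandsbergRyder2015, §3 Prop. 3.1] -/
theorem glueBlock₁_apply (p q : ℕ) (I I' : Fin (p + 1 + q)) (u α α' u' : Fin 2) :
    glueBlock₁ K p q (I, u) (I', α) (α', u') =
      if (I : ℕ) ≤ p ∧ (I' : ℕ) ≤ p then
        (if p - (I' : ℕ) = 0 ∧ α = 0 then 0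
         else if p - (I : ℕ) = p - (I' : ℕ) ∧ α = α' ∧ u = u' then 1 else 0)
      else 0 := by
  unfold glueBlock₁ optPullTensor glueMap₁ reducedM22 matMulTensor
  by_cases h1 : (I : ℕ) ≤ p <;> by_cases h2 : (I' : ℕ) ≤ p <;> simp [h1, h2]

/-- Closed form of the second summand at a point. [cite: LandsbergRyder2015, §3 Prop. 3.1] -/
theorem glueBlock₂_apply (p q : ℕ) (I I' : Fin (p + 1 + q)) (u α α' u' : Fin 2) :
    glueBlock₂ K p q (I, u) (I', α) (α', u') =
      if p ≤ (I : ℕ) ∧ p ≤ (I' : ℕ) then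
        (if (I' : ℕ) - p = 0 ∧ α.rev = 0 then 0
         else if (I : ℕ) - p = (I' : ℕ) - p ∧ α.rev = α'.rev ∧ u = u' then 1 else 0)
      else 0 := by
  unfold glueBlock₂ optPullTensor glueMap₂ glueMap₂' reducedM22 matMulTensor
  by_cases h1 : p ≤ (I : ℕ) <;> by_cases h2 : p ≤ (I' : ℕ) <;> simp [h1, h2]

/-- **The gluing identity**: `M_⟨p+1+q,2,2⟩ = T₁ + T₂` (the shared row `p` is split: the term through
`x_{p,1}` comes from the first block, the term through `x_{p,0}` from the second).
[cite: LandsbergRyder2015, §3 Prop. 3.1] -/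
theorem matMulTensor_eq_glue (p q : ℕ) :
    matMulTensor K (p + 1 + q) 2 2 = glueBlock₁ K p q + glueBlock₂ K p q := by
  have r0 : Fin.rev (0 : Fin 2) = 1 := by decide
  have r1 : Fin.rev (1 : Fin 2) = 0 := by decide
  funext c a b
  obtain ⟨I, u⟩ := c
  obtain ⟨I', α⟩ := a
  obtain ⟨α', u'⟩ := b
  have hI := I.isLt
  have hI' := I'.isLt
  have e : (I = I') ↔ ((I : ℕ) = (I' : ℕ)) := Fin.ext_iff
  simp only [Pi.add_apply, glueBlock₁_apply, glueBlock₂_apply, matMulTensor, e]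
  fin_cases u <;> fin_cases u' <;> fin_cases α <;> fin_cases α' <;> simp [r0, r1] <;>
    split_ifs <;> first | (simp; done) | (exfalso; omega)

variable {K}

/-- **Gluing bound** (the content of Landsberg–Ryder Prop. 3.1, every commutative ring):
`bR(M_⟨p+1+q,2,2⟩) ≤ bR(T_{BCLRS,p+1}) + bR(T_{BCLRS,q+1})`. [cite: LandsbergRyder2015, §3 Prop. 3.1] -/
theorem algBorderRank_matMulTensor_glue_le (p q : ℕ) :
    algBorderRank (matMulTensor K (p + 1 + q) 2 2) ≤
      algBorderRank (reducedM22 K p) + algBorderRank (reducedM22 K q) := by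
  rw [matMulTensor_eq_glue K p q]
  refine (algBorderRank_add_le _ _).trans (Nat.add_le_add ?_ ?_)
  · exact algBorderRank_optPull_le _ _ _ _
  · exact algBorderRank_optPull_le _ _ _ _

/-- **Discharge of `LandsbergRyder2017_prop_3_1`** (Landsberg–Ryder 2017, Prop. 3.1: gluing two reduced
schemes along the shared row of `X`). [cite: LandsbergRyder2015, §3 Prop. 3.1] -/
theorem LandsbergRyder2017_prop_3_1_holds : LandsbergRyder2017_prop_3_1 := by
  intro m m' r r' hm hm' h₁ h₂
  obtain ⟨p, rfl⟩ : ∃ p, m = p + 1 := ⟨m - 1, by omega⟩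
  obtain ⟨q, rfl⟩ : ∃ q, m' = q + 1 := ⟨m' - 1, by omega⟩
  have e : p + 1 + (q + 1) - 1 = p + 1 + q := by omega
  rw [e]
  have key : ∀ (n : ℕ) (hn : 0 < n + 1) (a : Fin (n + 1) × Fin 2),
      (a = (⟨0, hn⟩, 0)) = (a.1.val = 0 ∧ a.2 = 0) := by
    intro n hn a
    obtain ⟨a1, a2⟩ := a
    apply propext
    constructor
    · intro h
      have h' := Prod.mk.inj h
      exact ⟨by rw [h'.1], h'.2⟩
    · rintro ⟨h1, h2⟩
      exact Prod.ext (Fin.ext h1) h2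
  have h₁' : algBorderRank (reducedM22 ℂ p) ≤ r := by
    have e : reducedM22 ℂ p = fun c a b =>
        if a = (⟨0, hm⟩, 0) then 0 else matMulTensor ℂ (p + 1) 2 2 c a b := by
      funext c a b
      exact if_congr (Iff.of_eq (key p hm a)).symm rfl rfl
    rw [e]
    exact h₁
  have h₂' : algBorderRank (reducedM22 ℂ q) ≤ r' := by
    have e : reducedM22 ℂ q = fun c a b =>
        if a = (⟨0, hm'⟩, 0) then 0 else matMulTensor ℂ (q + 1) 2 2 c a b := by
      funext c a b
      exact if_congr (Iff.of_eq (key q hm' a)).symm rfl rfl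
    rw [e]
    exact h₂
  exact (algBorderRank_matMulTensor_glue_le p q).trans (Nat.add_le_add h₁' h₂')

end Literature.Computability.AlgebraicComplexity

end
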